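import Summits.Ventures.CertifiedManyBodySolver.Downfold.EmeryBoxesLa214JetWindowX0P1
import Summits.Ventures.CertifiedManyBodySolver.Downfold.EmeryBoxesLa214JetWindowX0P2
import Summits.Ventures.CertifiedManyBodySolver.Downfold.EmeryBoxesLa214JetWindowX0P3
import Summits.Ventures.CertifiedManyBodySolver.Downfold.EmeryBoxesLa214JetWindowX0P4
import Summits.Ventures.CertifiedManyBodySolver.Downfold.EmeryBoxesLa214JetWindowX0P5
import Summits.Ventures.CertifiedManyBodySolver.Downfold.EmeryBoxesLa214JetWindowX0P6
import Summits.Ventures.CertifiedManyBodySolver.Downfold.EmeryFermiFillingLa214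
import HarnessLib

/-!
# THE WHOLE-BAND (OBJECT-M) ONE-BAND SET AS CERTIFIED WINDOWS — La₂CuO₄, x = 0 (ν = 1/2) — ASSEMBLED: `(t_J, t′_J/t_J, t″_J/t_J)` of the nodal 2-jet at ε_F
# for EVERY member of box #18's σ companion `emeryBoxLa214v123` (INFL-3to1-B §B.101)

Venture CertifiedManyBodySolver, cell `pub/hubbard-downfold` (stage S1; INFLATION-RULES-3to1-B §B.101), seat hubbard-downfold-mod-4 (technique B = band
level, g45); namespace `Summit.Ventures.CertifiedManyBodySolver.Downfold.Emery`. Everything PROVED (`decide +kernel` on the bisection certificates of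
`EmeryBandJetWindow.jetLeaf` — slope arithmetic `EmerySlopeArith(Sound)` — composed with the sub-box ε_F brackets of `EmeryFermiFillingLa214Subs` and
`abFilling_fermiEnergyOf'`; generator HOME/hubbard-downfold-mod-4/jet-g45/gen/emit_boxes2.py, bit-exact python mirror of the kernel checker).
WHAT THIS IS NOT: a statement about La₂CuO₄ — the typed box (box #18's σ companion `emeryBoxLa214v123` (La₂CuO₄; Δ_pd [1.7, 4.0] × t_pd [1.29, 1.52] × t_pp [0.46, 0.66] × t_pp′ [0.12, 0.15] eV, THREE-BAND (3BE) COMPANION)) is SCREENING-GRADE; `U = 0` one-body kinematics of the σ model; the ε_F coupling is per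
SUB-BOX (each member's jet is bounded over its sub-box's certified ε_F bracket, not at its own ε_F), so the windows are OUTER bounds of the true ranges (float: x = 0 true coupled range t′_J/t_J ∈ [−0.090, −0.012], t″_J/t_J ∈ [0.072, 0.130]).

| Δ_pd range | window |
|---|---|
| whole Δ_pd hull [1.7, 4.0] | t_J [0.2731, 0.5290] eV, t′_J/t_J [-0.1162, 0.0347], t″_J/t_J [0.0373, 0.2372] |
| DFT-level Δ_pd tag [1.7, 2.91] | t_J [0.3006, 0.5290] eV, t′_J/t_J [-0.1133, 0.0347], t″_J/t_J [0.0447, 0.2372] |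
| solver-level Δ_pd tag [3.24, 4.0] | t_J [0.2731, 0.4817] eV, t′_J/t_J [-0.1162, 0.0143], t″_J/t_J [0.0373, 0.1586] |

Sources: [HybertsenSchluterChristensen1989, Eq. (1)]; [AndersenEtAl1995, §6]; [PavariniEtAl2001, Eq. (1)]; interval/slope arithmetic [folklore].
-/

noncomputable section

namespace Summit.Ventures.CertifiedManyBodySolver.Downfold.Emery

open Real Set Literature.Analysis.ValidatedNumerics.Numerics

/-- **La₂CuO₄, whole Δ_pd hull [1.7, 4.0], x = 0 (ν = 1/2)** — for EVERY member θ = (Δ, t_pd, t_pp, t_pp′), with ε = ε_F(θ) and x₀ = xNode(ε_F): nodal-jet hopping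
`t_J ∈ [0.2731, 0.5290]` eV, `t′_J/t_J ∈ [-0.1162, 0.0347]`, `t″_J/t_J ∈ [0.0373, 0.2372]` (union of the sub-box windows 0_0, 0_1, 1_0, 1_1, 2_0, 2_1, 3_0, 3_1, 4_0, 4_1, 5_0, 5_1, 6_0, 6_1, 7_0, 7_1). [folklore] -/
theorem la214Box_jetWindow_x0 {Δ a b c : ℝ} (hΔ : Δ ∈ Icc (17 / 10 : ℝ) (4 : ℝ)) (ha : a ∈ Icc (129 / 100 : ℝ) (38 / 25 : ℝ))
    (hb : b ∈ Icc (23 / 50 : ℝ) (33 / 50 : ℝ)) (hc : c ∈ Icc (3 / 25 : ℝ) (3 / 20 : ℝ)) :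
    jetT Δ a b c (xNode Δ a b c (fermiEnergyOf Δ a b c (1 / 2 : ℝ))) (fermiEnergyOf Δ a b c (1 / 2 : ℝ)) ∈ Icc (2731 / 10000 : ℝ) (529 / 1000 : ℝ) ∧
      jetTp Δ a b c (xNode Δ a b c (fermiEnergyOf Δ a b c (1 / 2 : ℝ))) (fermiEnergyOf Δ a b c (1 / 2 : ℝ)) / jetT Δ a b c (xNode Δ a b c (fermiEnergyOf Δ a b c (1 / 2 : ℝ))) (fermiEnergyOf Δ a b c (1 / 2 : ℝ)) ∈ Icc (-581 / 5000 : ℝ) (347 / 10000 : ℝ) ∧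
      jetTpp Δ a b c (xNode Δ a b c (fermiEnergyOf Δ a b c (1 / 2 : ℝ))) (fermiEnergyOf Δ a b c (1 / 2 : ℝ)) / jetT Δ a b c (xNode Δ a b c (fermiEnergyOf Δ a b c (1 / 2 : ℝ))) (fermiEnergyOf Δ a b c (1 / 2 : ℝ)) ∈ Icc (373 / 10000 : ℝ) (593 / 2500 : ℝ) := by
  rcases mem_Icc_split hΔ (57 / 20 : ℝ) with hΔ | hΔ
  · rcases mem_Icc_split hΔ (91 / 40 : ℝ) with hΔ | hΔ
    · rcases mem_Icc_split hΔ (159 / 80 : ℝ) with hΔ | hΔ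
      · rcases mem_Icc_split ha (281 / 200 : ℝ) with ha' | ha'
        · exact (la214X0Jet_0_0 hΔ ha' hb hc).widen (by norm_num [SC]) (by norm_num [SC]) (by norm_num [SC])
            (by norm_num [SC]) (by norm_num [SC]) (by norm_num [SC])
        · exact (la214X0Jet_0_1 hΔ ha' hb hc).widen (by norm_num [SC]) (by norm_num [SC]) (by norm_num [SC])
            (by norm_num [SC]) (by norm_num [SC]) (by norm_num [SC])
      · rcases mem_Icc_split ha (281 / 200 : ℝ) with ha' | ha'
        · exact (la214X0Jet_1_0 hΔ ha' hb hc).widen (by norm_num [SC]) (by norm_num [SC]) (by norm_num [SC])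
            (by norm_num [SC]) (by norm_num [SC]) (by norm_num [SC])
        · exact (la214X0Jet_1_1 hΔ ha' hb hc).widen (by norm_num [SC]) (by norm_num [SC]) (by norm_num [SC])
            (by norm_num [SC]) (by norm_num [SC]) (by norm_num [SC])
    · rcases mem_Icc_split hΔ (41 / 16 : ℝ) with hΔ | hΔ
      · rcases mem_Icc_split ha (281 / 200 : ℝ) with ha' | ha'
        · exact (la214X0Jet_2_0 hΔ ha' hb hc).widen (by norm_num [SC]) (by norm_num [SC]) (by norm_num [SC])
            (by norm_num [SC]) (by norm_num [SC]) (by norm_num [SC])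
        · exact (la214X0Jet_2_1 hΔ ha' hb hc).widen (by norm_num [SC]) (by norm_num [SC]) (by norm_num [SC])
            (by norm_num [SC]) (by norm_num [SC]) (by norm_num [SC])
      · rcases mem_Icc_split ha (281 / 200 : ℝ) with ha' | ha'
        · exact (la214X0Jet_3_0 hΔ ha' hb hc).widen (by norm_num [SC]) (by norm_num [SC]) (by norm_num [SC])
            (by norm_num [SC]) (by norm_num [SC]) (by norm_num [SC])
        · exact (la214X0Jet_3_1 hΔ ha' hb hc).widen (by norm_num [SC]) (by norm_num [SC]) (by norm_num [SC])
            (by norm_num [SC]) (by norm_num [SC]) (by norm_num [SC])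
  · rcases mem_Icc_split hΔ (137 / 40 : ℝ) with hΔ | hΔ
    · rcases mem_Icc_split hΔ (251 / 80 : ℝ) with hΔ | hΔ
      · rcases mem_Icc_split ha (281 / 200 : ℝ) with ha' | ha'
        · exact (la214X0Jet_4_0 hΔ ha' hb hc).widen (by norm_num [SC]) (by norm_num [SC]) (by norm_num [SC])
            (by norm_num [SC]) (by norm_num [SC]) (by norm_num [SC])
        · exact (la214X0Jet_4_1 hΔ ha' hb hc).widen (by norm_num [SC]) (by norm_num [SC]) (by norm_num [SC])
            (by norm_num [SC]) (by norm_num [SC]) (by norm_num [SC])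
      · rcases mem_Icc_split ha (281 / 200 : ℝ) with ha' | ha'
        · exact (la214X0Jet_5_0 hΔ ha' hb hc).widen (by norm_num [SC]) (by norm_num [SC]) (by norm_num [SC])
            (by norm_num [SC]) (by norm_num [SC]) (by norm_num [SC])
        · exact (la214X0Jet_5_1 hΔ ha' hb hc).widen (by norm_num [SC]) (by norm_num [SC]) (by norm_num [SC])
            (by norm_num [SC]) (by norm_num [SC]) (by norm_num [SC])
    · rcases mem_Icc_split hΔ (297 / 80 : ℝ) with hΔ | hΔ
      · rcases mem_Icc_split ha (281 / 200 : ℝ) with ha' | ha'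
        · exact (la214X0Jet_6_0 hΔ ha' hb hc).widen (by norm_num [SC]) (by norm_num [SC]) (by norm_num [SC])
            (by norm_num [SC]) (by norm_num [SC]) (by norm_num [SC])
        · exact (la214X0Jet_6_1 hΔ ha' hb hc).widen (by norm_num [SC]) (by norm_num [SC]) (by norm_num [SC])
            (by norm_num [SC]) (by norm_num [SC]) (by norm_num [SC])
      · rcases mem_Icc_split ha (281 / 200 : ℝ) with ha' | ha'
        · exact (la214X0Jet_7_0 hΔ ha' hb hc).widen (by norm_num [SC]) (by norm_num [SC]) (by norm_num [SC])
            (by norm_num [SC]) (by norm_num [SC]) (by norm_num [SC])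
        · exact (la214X0Jet_7_1 hΔ ha' hb hc).widen (by norm_num [SC]) (by norm_num [SC]) (by norm_num [SC])
            (by norm_num [SC]) (by norm_num [SC]) (by norm_num [SC])

/-- **La₂CuO₄, DFT-level Δ_pd tag [1.7, 2.91], x = 0 (ν = 1/2)** — for EVERY member θ = (Δ, t_pd, t_pp, t_pp′), with ε = ε_F(θ) and x₀ = xNode(ε_F): nodal-jet hopping
`t_J ∈ [0.3006, 0.5290]` eV, `t′_J/t_J ∈ [-0.1133, 0.0347]`, `t″_J/t_J ∈ [0.0447, 0.2372]` (union of the sub-box windows 0_0, 0_1, 1_0, 1_1, 2_0, 2_1, 3_0, 3_1, 4_0, 4_1). [folklore] -/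
theorem la214DFTBox_jetWindow_x0 {Δ a b c : ℝ} (hΔ : Δ ∈ Icc (17 / 10 : ℝ) (291 / 100 : ℝ)) (ha : a ∈ Icc (129 / 100 : ℝ) (38 / 25 : ℝ))
    (hb : b ∈ Icc (23 / 50 : ℝ) (33 / 50 : ℝ)) (hc : c ∈ Icc (3 / 25 : ℝ) (3 / 20 : ℝ)) :
    jetT Δ a b c (xNode Δ a b c (fermiEnergyOf Δ a b c (1 / 2 : ℝ))) (fermiEnergyOf Δ a b c (1 / 2 : ℝ)) ∈ Icc (1503 / 5000 : ℝ) (529 / 1000 : ℝ) ∧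
      jetTp Δ a b c (xNode Δ a b c (fermiEnergyOf Δ a b c (1 / 2 : ℝ))) (fermiEnergyOf Δ a b c (1 / 2 : ℝ)) / jetT Δ a b c (xNode Δ a b c (fermiEnergyOf Δ a b c (1 / 2 : ℝ))) (fermiEnergyOf Δ a b c (1 / 2 : ℝ)) ∈ Icc (-1133 / 10000 : ℝ) (347 / 10000 : ℝ) ∧
      jetTpp Δ a b c (xNode Δ a b c (fermiEnergyOf Δ a b c (1 / 2 : ℝ))) (fermiEnergyOf Δ a b c (1 / 2 : ℝ)) / jetT Δ a b c (xNode Δ a b c (fermiEnergyOf Δ a b c (1 / 2 : ℝ))) (fermiEnergyOf Δ a b c (1 / 2 : ℝ)) ∈ Icc (447 / 10000 : ℝ) (593 / 2500 : ℝ) := by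
  rcases mem_Icc_split hΔ (91 / 40 : ℝ) with hΔ | hΔ
  · rcases mem_Icc_split hΔ (159 / 80 : ℝ) with hΔ | hΔ
    · rcases mem_Icc_split ha (281 / 200 : ℝ) with ha' | ha'
      · exact (la214X0Jet_0_0 hΔ ha' hb hc).widen (by norm_num [SC]) (by norm_num [SC]) (by norm_num [SC])
          (by norm_num [SC]) (by norm_num [SC]) (by norm_num [SC])
      · exact (la214X0Jet_0_1 hΔ ha' hb hc).widen (by norm_num [SC]) (by norm_num [SC]) (by norm_num [SC])
          (by norm_num [SC]) (by norm_num [SC]) (by norm_num [SC])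
    · rcases mem_Icc_split ha (281 / 200 : ℝ) with ha' | ha'
      · exact (la214X0Jet_1_0 hΔ ha' hb hc).widen (by norm_num [SC]) (by norm_num [SC]) (by norm_num [SC])
          (by norm_num [SC]) (by norm_num [SC]) (by norm_num [SC])
      · exact (la214X0Jet_1_1 hΔ ha' hb hc).widen (by norm_num [SC]) (by norm_num [SC]) (by norm_num [SC])
          (by norm_num [SC]) (by norm_num [SC]) (by norm_num [SC])
  · rcases mem_Icc_split hΔ (41 / 16 : ℝ) with hΔ | hΔ
    · rcases mem_Icc_split ha (281 / 200 : ℝ) with ha' | ha'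
      · exact (la214X0Jet_2_0 hΔ ha' hb hc).widen (by norm_num [SC]) (by norm_num [SC]) (by norm_num [SC])
          (by norm_num [SC]) (by norm_num [SC]) (by norm_num [SC])
      · exact (la214X0Jet_2_1 hΔ ha' hb hc).widen (by norm_num [SC]) (by norm_num [SC]) (by norm_num [SC])
          (by norm_num [SC]) (by norm_num [SC]) (by norm_num [SC])
    · rcases mem_Icc_split hΔ (57 / 20 : ℝ) with hΔ | hΔ
      · rcases mem_Icc_split ha (281 / 200 : ℝ) with ha' | ha'
        · exact (la214X0Jet_3_0 hΔ ha' hb hc).widen (by norm_num [SC]) (by norm_num [SC]) (by norm_num [SC])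
            (by norm_num [SC]) (by norm_num [SC]) (by norm_num [SC])
        · exact (la214X0Jet_3_1 hΔ ha' hb hc).widen (by norm_num [SC]) (by norm_num [SC]) (by norm_num [SC])
            (by norm_num [SC]) (by norm_num [SC]) (by norm_num [SC])
      · rcases mem_Icc_split ha (281 / 200 : ℝ) with ha' | ha'
        · exact (la214X0Jet_4_0 (⟨le_trans (by norm_num) hΔ.1, hΔ.2.trans (by norm_num)⟩) ha' hb hc).widen (by norm_num [SC]) (by norm_num [SC]) (by norm_num [SC])
            (by norm_num [SC]) (by norm_num [SC]) (by norm_num [SC])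
        · exact (la214X0Jet_4_1 (⟨le_trans (by norm_num) hΔ.1, hΔ.2.trans (by norm_num)⟩) ha' hb hc).widen (by norm_num [SC]) (by norm_num [SC]) (by norm_num [SC])
            (by norm_num [SC]) (by norm_num [SC]) (by norm_num [SC])

/-- **La₂CuO₄, solver-level Δ_pd tag [3.24, 4.0], x = 0 (ν = 1/2)** — for EVERY member θ = (Δ, t_pd, t_pp, t_pp′), with ε = ε_F(θ) and x₀ = xNode(ε_F): nodal-jet hopping
`t_J ∈ [0.2731, 0.4817]` eV, `t′_J/t_J ∈ [-0.1162, 0.0143]`, `t″_J/t_J ∈ [0.0373, 0.1586]` (union of the sub-box windows 5_0, 5_1, 6_0, 6_1, 7_0, 7_1). [folklore] -/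
theorem la214SOLBox_jetWindow_x0 {Δ a b c : ℝ} (hΔ : Δ ∈ Icc (81 / 25 : ℝ) (4 : ℝ)) (ha : a ∈ Icc (129 / 100 : ℝ) (38 / 25 : ℝ))
    (hb : b ∈ Icc (23 / 50 : ℝ) (33 / 50 : ℝ)) (hc : c ∈ Icc (3 / 25 : ℝ) (3 / 20 : ℝ)) :
    jetT Δ a b c (xNode Δ a b c (fermiEnergyOf Δ a b c (1 / 2 : ℝ))) (fermiEnergyOf Δ a b c (1 / 2 : ℝ)) ∈ Icc (2731 / 10000 : ℝ) (4817 / 10000 : ℝ) ∧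
      jetTp Δ a b c (xNode Δ a b c (fermiEnergyOf Δ a b c (1 / 2 : ℝ))) (fermiEnergyOf Δ a b c (1 / 2 : ℝ)) / jetT Δ a b c (xNode Δ a b c (fermiEnergyOf Δ a b c (1 / 2 : ℝ))) (fermiEnergyOf Δ a b c (1 / 2 : ℝ)) ∈ Icc (-581 / 5000 : ℝ) (143 / 10000 : ℝ) ∧
      jetTpp Δ a b c (xNode Δ a b c (fermiEnergyOf Δ a b c (1 / 2 : ℝ))) (fermiEnergyOf Δ a b c (1 / 2 : ℝ)) / jetT Δ a b c (xNode Δ a b c (fermiEnergyOf Δ a b c (1 / 2 : ℝ))) (fermiEnergyOf Δ a b c (1 / 2 : ℝ)) ∈ Icc (373 / 10000 : ℝ) (793 / 5000 : ℝ) := by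
  rcases mem_Icc_split hΔ (137 / 40 : ℝ) with hΔ | hΔ
  · rcases mem_Icc_split ha (281 / 200 : ℝ) with ha' | ha'
    · exact (la214X0Jet_5_0 (⟨le_trans (by norm_num) hΔ.1, hΔ.2.trans (by norm_num)⟩) ha' hb hc).widen (by norm_num [SC]) (by norm_num [SC]) (by norm_num [SC])
        (by norm_num [SC]) (by norm_num [SC]) (by norm_num [SC])
    · exact (la214X0Jet_5_1 (⟨le_trans (by norm_num) hΔ.1, hΔ.2.trans (by norm_num)⟩) ha' hb hc).widen (by norm_num [SC]) (by norm_num [SC]) (by norm_num [SC])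
        (by norm_num [SC]) (by norm_num [SC]) (by norm_num [SC])
  · rcases mem_Icc_split hΔ (297 / 80 : ℝ) with hΔ | hΔ
    · rcases mem_Icc_split ha (281 / 200 : ℝ) with ha' | ha'
      · exact (la214X0Jet_6_0 hΔ ha' hb hc).widen (by norm_num [SC]) (by norm_num [SC]) (by norm_num [SC])
          (by norm_num [SC]) (by norm_num [SC]) (by norm_num [SC])
      · exact (la214X0Jet_6_1 hΔ ha' hb hc).widen (by norm_num [SC]) (by norm_num [SC]) (by norm_num [SC])
          (by norm_num [SC]) (by norm_num [SC]) (by norm_num [SC])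
    · rcases mem_Icc_split ha (281 / 200 : ℝ) with ha' | ha'
      · exact (la214X0Jet_7_0 hΔ ha' hb hc).widen (by norm_num [SC]) (by norm_num [SC]) (by norm_num [SC])
          (by norm_num [SC]) (by norm_num [SC]) (by norm_num [SC])
      · exact (la214X0Jet_7_1 hΔ ha' hb hc).widen (by norm_num [SC]) (by norm_num [SC]) (by norm_num [SC])
          (by norm_num [SC]) (by norm_num [SC]) (by norm_num [SC])

end Summit.Ventures.CertifiedManyBodySolver.Downfold.Emery
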